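import Summits.AnomalousDissipation.AnomalousDissipation.Theorems.SolenoidalFractalHomogenisationLagrangianStepCellLawVSlowGraphBall
import Mathlib.Analysis.ODE.Gronwall
import HarnessLib

/-!
# K1L `LagrangianRenormalisationStep(Design)` (K1L_D, stmt-AnomalousDissipation-27980; aside 24912), stub `stub_cellLawV0_IS`
# — the ABSTRACT SLOW-GRAPH LEVER, part 2: EXACT REDUCTION to the Riccati graph and the DUHAMEL REMAINDER
# (`SlowGraphSketch` G2 `GraphReduction` + G3 `DuhamelRemainder`, VERBATIM bodies, PROVED; helper; `--supports stmt-AnomalousDissipation-27980`; word-independent)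

Summits-side helper file of route `SolenoidalFractalHomogenisation` (planner ad-ideate-p5's STUB-PLAN for `stub_cellLawV`,
`Cruxes/LagrangianRenormalisationStep/STUB-IDEAS-stub_cellLawV-p5.md` §1 (V) steps V1–V3 and §7 (a) (tenure D24-1: `Φν` := the period mean of the REDUCED
slow generator `A₁₁ + A₁₂L` on the Riccati graph), crux idea `chang-slow-graph`, sketch `Cruxes/LagrangianRenormalisationStep/SlowGraphSketch.lean` §G
«the abstract lever», G2 and G3; on top of part 1 `…CellLawVSlowGraphBall` (G1 `riccatiInvariantBall`, p661616)).  The Cruxes sketch is not importable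
on the farm, so the bodies of its `def GraphReduction : Prop` / `def DuhamelRemainder : Prop` are restated here VERBATIM as theorems and proved.

* §4 **G2 `graphReduction`** — along a solution `L` of Chang's Riccati equation `L̇ = A₂₁ + A₂₂L − LA₁₁ − LA₁₂L` the graph `z = Lx` is invariant
  under the block flow `ẋ = A₁₁x + A₁₂z`, `ż = A₂₁x + A₂₂z` and carries the REDUCED slow dynamics `ẋ = (A₁₁ + A₁₂L)x` EXACTLY: the defect
  `η = z − Lx` solves `η̇ = (A₂₂ − LA₁₂)η`, `η(0) = 0`, hence vanishes by Grönwall (`norm_le_gronwallBound_of_norm_deriv_right_le`, rate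
  `‖A₂₂‖ + ‖L‖‖A₁₂‖ ≤ B + B²`).  For the cell problem: the single-mode datum `Re e_ℓ·p` has no fast content, `z(0) = 0 = L(0)x(0)`, so the slow pair
  evolves by the reduced generator with NO Duhamel remainder (STUB-IDEAS V2).
* §5 **G3 `duhamelRemainder`** — under G1's hypotheses (`γ`-dissipative fast block, `‖A₁₁‖ ≤ s₀ < γ`, couplings `≤ δ`, `8δ² ≤ (γ−s₀)²`) the graph is
  its second-order (Duhamel) part `L₁`, `L̇₁ = A₂₁ + A₂₂L₁`, `L₁(0) = L(0)`, up to `‖L t − L₁ t‖ ≤ r(s₀ + δr)/γ`, `r = 2δ/(γ−s₀)`: the defect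
  `ρ = L − L₁` solves `ρ̇ = A₂₂ρ − LA₁₁ − LA₁₂L` with forcing of norm `≤ r s₀ + r²δ` (G1: `‖L‖ ≤ r`), and for each unit `ξ` the energy `‖ρξ‖²` is fenced
  under every level `(r(s₀+δr)/γ + ε)²` (`image_le_of_deriv_right_lt_deriv_boundary'`; `inner_apply_duhamelDefect_le`).  Relative to the leading
  excess `A₁₂L₁ = O(δ²/γ)` the error is `O((δ/γ)² + s₀/γ)` — the source of `σ = 2` in clause (V).
No named facts, no new definitions, no sorry.  Kokotović–Bensoussan–Blankenship 1987 §2 eq. (2.29), Thm 2.3 (Chang 1969/1972), §3 eq. (3.3)–(3.7),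
with the Hurwitz hypothesis replaced by energy dissipativity (dimension-free constants; the Galerkin cell system at one Bloch momentum is the instance,
uniformly in the truncation).  Infrastructure for route-1's rung leaf F-D1.A0 (frontier FORMAL rung); NOT a proof of the stub, of the crux, of Onsager's
conjecture or of anomalous dissipation.  Prover seat `ad-k1l-cellLawV-w1` g3, 2026-08-28.

## References
* P. V. Kokotović, A. Bensoussan, G. L. Blankenship (eds.), *Singular Perturbations and Asymptotic Analysis in Control Systems*, LNCIS 90,
  Springer 1987, §2 eq. (2.29), Thm 2.3; §3 eq. (3.3)–(3.7) [corpus: book:kokotovic1987, pp. 11–12].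
* K. W. Chang, *Singular perturbations of a general boundary value problem*, SIAM J. Math. Anal. 3 (1972) 520–526.
-/

set_option linter.dupNamespace false

noncomputable section

namespace Summit.AnomalousDissipation.AnomalousDissipation.Theorems.SolenoidalFractalHomogenisation.LagrangianStep

namespace SlowGraph

open Set Filter Topology
open scoped InnerProductSpace

/-! ## §4 G2 — exact reduction to the graph (`SlowGraphSketch.GraphReduction`, VERBATIM body, PROVED) -/

section Reduction

/-- **G2 `SlowGraphSketch.GraphReduction` (planner ad-ideate-p5, crux idea `chang-slow-graph`), VERBATIM body, PROVED — EXACT REDUCTION.**  Along a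
solution of the Riccati equation the graph `z = Lx` is invariant and carries the reduced slow dynamics `ẋ = (A₁₁ + A₁₂L)x`: if `(x, z)` solves the
block system with `z 0 = L 0 (x 0)` then `z t = L t (x t)` throughout — the defect `η = z − Lx` solves the homogeneous linear equation
`η̇ = (A₂₂ − LA₁₂)η` from `0`, so it vanishes by Grönwall (`norm_le_gronwallBound_of_norm_deriv_right_le`, bound `‖A₂₂‖ + ‖L‖‖A₁₂‖ ≤ B + B²`).
Kokotović–Bensoussan–Blankenship 1987 §3 eq. (3.5)–(3.7). [cite: KokotovicBensoussanBlankenship1987, §3 eq. (3.5)-(3.7)] -/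
theorem graphReduction : ∀ (E F : Type) [NormedAddCommGroup E] [InnerProductSpace ℝ E] [FiniteDimensional ℝ E]
    [NormedAddCommGroup F] [InnerProductSpace ℝ F] [FiniteDimensional ℝ F]
    (A₁₁ : ℝ → E →L[ℝ] E) (A₁₂ : ℝ → F →L[ℝ] E) (A₂₁ : ℝ → E →L[ℝ] F) (A₂₂ : ℝ → F →L[ℝ] F)
    (L : ℝ → E →L[ℝ] F) (x : ℝ → E) (z : ℝ → F) (T B : ℝ), 0 ≤ T →
    (∀ t ∈ Icc 0 T, ‖A₂₂ t‖ ≤ B ∧ ‖A₁₂ t‖ ≤ B ∧ ‖L t‖ ≤ B) →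
    (∀ t ∈ Ico 0 T, HasDerivAt L (A₂₁ t + (A₂₂ t).comp (L t) - (L t).comp (A₁₁ t) - ((L t).comp (A₁₂ t)).comp (L t)) t) →
    (∀ t ∈ Ico 0 T, HasDerivAt x (A₁₁ t (x t) + A₁₂ t (z t)) t) →
    (∀ t ∈ Ico 0 T, HasDerivAt z (A₂₁ t (x t) + A₂₂ t (z t)) t) →
    ContinuousOn L (Icc 0 T) → ContinuousOn x (Icc 0 T) → ContinuousOn z (Icc 0 T) →
    z 0 = L 0 (x 0) →
    (∀ t ∈ Icc 0 T, z t = L t (x t)) ∧ ∀ t ∈ Ico 0 T, HasDerivAt x ((A₁₁ t + (A₁₂ t).comp (L t)) (x t)) t := by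
  intro E F _ _ _ _ _ _ A₁₁ A₁₂ A₂₁ A₂₂ L x z T B hT hB hL hx hz hLc hxc hzc h0
  have hB0 : 0 ≤ B := le_trans (norm_nonneg _) (hB 0 ⟨le_rfl, hT⟩).1
  -- the defect `η = z − Lx` and its linear equation
  have hηderiv : ∀ t ∈ Ico 0 T,
      HasDerivAt (fun s => z s - L s (x s)) ((A₂₂ t - (L t).comp (A₁₂ t)) (z t - L t (x t))) t := by
    intro t ht
    have h2 : HasDerivAt (fun s => L s (x s))
        ((A₂₁ t + (A₂₂ t).comp (L t) - (L t).comp (A₁₁ t) - ((L t).comp (A₁₂ t)).comp (L t)) (x t) +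
          L t (A₁₁ t (x t) + A₁₂ t (z t))) t := (hL t ht).clm_apply (hx t ht)
    refine ((hz t ht).sub h2).congr_deriv ?_
    simp only [FunLike.coe_sub, FunLike.coe_add, Pi.sub_apply, Pi.add_apply, ContinuousLinearMap.comp_apply, map_sub, map_add]
    abel
  have hηcont : ContinuousOn (fun s => z s - L s (x s)) (Icc 0 T) := hzc.sub (hLc.clm_apply hxc)
  have hη0 : ‖z 0 - L 0 (x 0)‖ ≤ 0 := by rw [h0, sub_self, norm_zero]
  have hbound : ∀ t ∈ Ico 0 T, ‖(A₂₂ t - (L t).comp (A₁₂ t)) (z t - L t (x t))‖ ≤ (B + B * B) * ‖z t - L t (x t)‖ + 0 := by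
    intro t ht
    obtain ⟨h22, h12, hLB⟩ := hB t (Ico_subset_Icc_self ht)
    rw [add_zero]
    refine (ContinuousLinearMap.le_opNorm _ _).trans (mul_le_mul_of_nonneg_right ?_ (norm_nonneg _))
    calc ‖A₂₂ t - (L t).comp (A₁₂ t)‖ ≤ ‖A₂₂ t‖ + ‖(L t).comp (A₁₂ t)‖ := norm_sub_le _ _
      _ ≤ B + B * B := add_le_add h22 ((ContinuousLinearMap.opNorm_comp_le _ _).trans (mul_le_mul hLB h12 (norm_nonneg _) hB0))
  have hgron := norm_le_gronwallBound_of_norm_deriv_right_le (f := fun s => z s - L s (x s))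
    (f' := fun t => (A₂₂ t - (L t).comp (A₁₂ t)) (z t - L t (x t))) (δ := 0) (K := B + B * B) (ε := 0) (a := 0) (b := T)
    hηcont (fun t ht => (hηderiv t ht).hasDerivWithinAt) hη0 hbound
  have hgraph : ∀ t ∈ Icc 0 T, z t = L t (x t) := by
    intro t ht
    have h := hgron t ht
    rw [gronwallBound_ε0_δ0] at h
    exact sub_eq_zero.mp (norm_le_zero_iff.mp h)
  refine ⟨hgraph, fun t ht => ?_⟩
  have h := hx t ht
  rw [hgraph t (Ico_subset_Icc_self ht)] at h
  refine h.congr_deriv ?_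
  simp only [FunLike.coe_add, Pi.add_apply, ContinuousLinearMap.comp_apply]

end Reduction

/-! ## §5 G3 — the Duhamel remainder (`SlowGraphSketch.DuhamelRemainder`, VERBATIM body, PROVED) -/

section Duhamel

variable {E F : Type*} [NormedAddCommGroup E] [InnerProductSpace ℝ E] [NormedAddCommGroup F] [InnerProductSpace ℝ F]

/-- Pointwise energy inequality for the DUHAMEL DEFECT `ρ = L − L₁` (`L̇₁ = A₂₁ + A₂₂L₁`): with `v = ρ ξ`, `‖ξ‖ = 1`, `‖L‖ ≤ r`,
`⟪v, (L̇ − L̇₁)ξ⟫ ≤ −γ‖v‖² + r(s₀ + δr)‖v‖` (the defect solves `ρ̇ = A₂₂ρ − LA₁₁ − LA₁₂L`). [folklore] -/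
theorem inner_apply_duhamelDefect_le {A₁₁ : E →L[ℝ] E} {A₁₂ : F →L[ℝ] E} {A₂₁ : E →L[ℝ] F} {A₂₂ : F →L[ℝ] F} {L L₁ : E →L[ℝ] F}
    {γ δ s₀ r : ℝ} (hA₂₂ : ∀ z : F, ⟪A₂₂ z, z⟫_ℝ ≤ -γ * ‖z‖ ^ 2) (h₁₁ : ‖A₁₁‖ ≤ s₀) (h₁₂ : ‖A₁₂‖ ≤ δ) (hLr : ‖L‖ ≤ r)
    {ξ : E} (hξ : ‖ξ‖ = 1) :
    ⟪(L - L₁) ξ, ((A₂₁ + A₂₂.comp L - L.comp A₁₁ - (L.comp A₁₂).comp L) - (A₂₁ + A₂₂.comp L₁)) ξ⟫_ℝ ≤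
      -γ * ‖(L - L₁) ξ‖ ^ 2 + r * (s₀ + δ * r) * ‖(L - L₁) ξ‖ := by
  have hδ : 0 ≤ δ := le_trans (norm_nonneg _) h₁₂
  have hs₀ : 0 ≤ s₀ := le_trans (norm_nonneg _) h₁₁
  have hr : 0 ≤ r := le_trans (norm_nonneg _) hLr
  have e : ((A₂₁ + A₂₂.comp L - L.comp A₁₁ - (L.comp A₁₂).comp L) - (A₂₁ + A₂₂.comp L₁)) ξ =
      A₂₂ ((L - L₁) ξ) - L (A₁₁ ξ) - L (A₁₂ (L ξ)) := by
    simp only [FunLike.coe_sub, FunLike.coe_add, Pi.sub_apply, Pi.add_apply, ContinuousLinearMap.comp_apply, map_sub]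
    abel
  rw [e, inner_sub_right, inner_sub_right]
  set v := (L - L₁) ξ with hv
  have t1 : ⟪v, A₂₂ v⟫_ℝ ≤ -γ * ‖v‖ ^ 2 := by rw [real_inner_comm]; exact hA₂₂ v
  have t2 : -⟪v, L (A₁₁ ξ)⟫_ℝ ≤ ‖v‖ * (r * s₀) := by
    have h : |⟪v, L (A₁₁ ξ)⟫_ℝ| ≤ ‖v‖ * ‖L (A₁₁ ξ)‖ := abs_real_inner_le_norm _ _
    have h' : ‖L (A₁₁ ξ)‖ ≤ r * s₀ := by
      calc ‖L (A₁₁ ξ)‖ ≤ ‖L‖ * ‖A₁₁ ξ‖ := L.le_opNorm _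
        _ ≤ ‖L‖ * (‖A₁₁‖ * ‖ξ‖) := mul_le_mul_of_nonneg_left (A₁₁.le_opNorm ξ) (norm_nonneg _)
        _ ≤ r * (s₀ * 1) := by rw [hξ]; exact mul_le_mul hLr (mul_le_mul_of_nonneg_right h₁₁ zero_le_one) (by positivity) hr
        _ = r * s₀ := by ring
    have := (abs_le.mp (h.trans (mul_le_mul_of_nonneg_left h' (norm_nonneg _)))).1
    linarith
  have t3 : -⟪v, L (A₁₂ (L ξ))⟫_ℝ ≤ ‖v‖ * (r * (δ * r)) := by
    have h : |⟪v, L (A₁₂ (L ξ))⟫_ℝ| ≤ ‖v‖ * ‖L (A₁₂ (L ξ))‖ := abs_real_inner_le_norm _ _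
    have h' : ‖L (A₁₂ (L ξ))‖ ≤ r * (δ * r) := by
      calc ‖L (A₁₂ (L ξ))‖ ≤ ‖L‖ * ‖A₁₂ (L ξ)‖ := L.le_opNorm _
        _ ≤ ‖L‖ * (‖A₁₂‖ * ‖L ξ‖) := mul_le_mul_of_nonneg_left (A₁₂.le_opNorm _) (norm_nonneg _)
        _ ≤ ‖L‖ * (‖A₁₂‖ * (‖L‖ * ‖ξ‖)) :=
            mul_le_mul_of_nonneg_left (mul_le_mul_of_nonneg_left (L.le_opNorm ξ) (norm_nonneg _)) (norm_nonneg _)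
        _ ≤ r * (δ * (r * 1)) := by
            rw [hξ]
            exact mul_le_mul hLr (mul_le_mul h₁₂ (mul_le_mul_of_nonneg_right hLr zero_le_one) (by positivity) hδ)
              (by positivity) hr
        _ = r * (δ * r) := by ring
    have := (abs_le.mp (h.trans (mul_le_mul_of_nonneg_left h' (norm_nonneg _)))).1
    linarith
  nlinarith [t1, t2, t3]

/-- **G3 `SlowGraphSketch.DuhamelRemainder` (planner ad-ideate-p5, crux idea `chang-slow-graph`), VERBATIM body, PROVED — THE DUHAMEL REMAINDER.**
Under the hypotheses of G1 the graph is its second-order (Duhamel) part up to a relatively QUADRATIC error in coupling/gap: if `L̇₁ = A₂₁ + A₂₂L₁`,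
`L₁ 0 = L 0`, then `‖L t − L₁ t‖ ≤ r(s₀ + δr)/γ`, `r = 2δ/(γ−s₀)` (the defect solves `ρ̇ = A₂₂ρ − LA₁₁ − LA₁₂L` with forcing of norm `≤ rs₀ + r²δ`
by G1, and `ξ ↦ ρξ` is `γ`-damped for each fixed unit `ξ`: fencing of `‖ρξ‖²` under every level `(r(s₀+δr)/γ + ε)²`).  Hence the reduced generator is
`A₁₁ + A₁₂L₁ + O(δ·r·(s₀+δr)/γ)` — the source of `σ = 2` in clause (V). [cite: KokotovicBensoussanBlankenship1987, §2 Thm 2.3] -/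
theorem duhamelRemainder : ∀ (E F : Type) [NormedAddCommGroup E] [InnerProductSpace ℝ E] [FiniteDimensional ℝ E]
    [NormedAddCommGroup F] [InnerProductSpace ℝ F] [FiniteDimensional ℝ F]
    (A₁₁ : ℝ → E →L[ℝ] E) (A₁₂ : ℝ → F →L[ℝ] E) (A₂₁ : ℝ → E →L[ℝ] F) (A₂₂ : ℝ → F →L[ℝ] F)
    (L L₁ : ℝ → E →L[ℝ] F) (γ δ s₀ T : ℝ),
    0 < γ → 0 ≤ δ → 0 ≤ s₀ → s₀ < γ → 8 * δ ^ 2 ≤ (γ - s₀) ^ 2 → 0 ≤ T →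
    (∀ t ∈ Icc 0 T, ∀ z : F, ⟪A₂₂ t z, z⟫_ℝ ≤ -γ * ‖z‖ ^ 2) →
    (∀ t ∈ Icc 0 T, ‖A₁₁ t‖ ≤ s₀) → (∀ t ∈ Icc 0 T, ‖A₁₂ t‖ ≤ δ) → (∀ t ∈ Icc 0 T, ‖A₂₁ t‖ ≤ δ) →
    (∀ t ∈ Ico 0 T, HasDerivAt L (A₂₁ t + (A₂₂ t).comp (L t) - (L t).comp (A₁₁ t) - ((L t).comp (A₁₂ t)).comp (L t)) t) →
    (∀ t ∈ Ico 0 T, HasDerivAt L₁ (A₂₁ t + (A₂₂ t).comp (L₁ t)) t) →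
    ContinuousOn L (Icc 0 T) → ContinuousOn L₁ (Icc 0 T) → L₁ 0 = L 0 →
    ‖L 0‖ ≤ 2 * δ / (γ - s₀) →
    ∀ t ∈ Icc 0 T, ‖L t - L₁ t‖ ≤ (2 * δ / (γ - s₀)) * (s₀ + δ * (2 * δ / (γ - s₀))) / γ := by
  intro E F _ _ _ _ _ _ A₁₁ A₁₂ A₂₁ A₂₂ L L₁ γ δ s₀ T hγ hδ hs₀ hsγ h8 hT hA₂₂ h₁₁ h₁₂ h₂₁ hL hL₁ hLc hL₁c h10 h0 t ht
  -- G1: the graph stays in the ball of radius `r`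
  have hball := riccatiInvariantBall E F A₁₁ A₁₂ A₂₁ A₂₂ L γ δ s₀ T hγ hδ hs₀ hsγ h8 hT hA₂₂ h₁₁ h₁₂ h₂₁ hL hLc h0
  set r := 2 * δ / (γ - s₀) with hr
  have hgs : 0 < γ - s₀ := by linarith
  have hr0 : 0 ≤ r := by positivity
  set Fk := r * (s₀ + δ * r) with hFk
  have hFk0 : 0 ≤ Fk := by positivity
  have hgoal : 0 ≤ Fk / γ := by positivity
  -- unit-sphere reduction
  refine ContinuousLinearMap.opNorm_le_of_unit_norm hgoal fun ξ hξ => ?_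
  -- for every `ε > 0`, `‖(L t − L₁ t) ξ‖ ≤ Fk/γ + ε` by fencing `‖(L s − L₁ s) ξ‖²` under `(Fk/γ + ε)²`
  refine le_of_forall_pos_le_add fun ε hε => ?_
  set m := Fk / γ + ε with hm
  have hmpos : 0 < m := by positivity
  have hvcont : ContinuousOn (fun s => ‖(L s - L₁ s) ξ‖ ^ 2) (Icc 0 T) :=
    (((hLc.sub hL₁c).clm_apply continuousOn_const).norm).pow 2
  have hvderiv : ∀ s ∈ Ico 0 T, HasDerivAt (fun s => (L s - L₁ s) ξ)
      (((A₂₁ s + (A₂₂ s).comp (L s) - (L s).comp (A₁₁ s) - ((L s).comp (A₁₂ s)).comp (L s)) - (A₂₁ s + (A₂₂ s).comp (L₁ s))) ξ) s := by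
    intro s hs
    have h := ((hL s hs).sub (hL₁ s hs)).clm_apply (hasDerivAt_const s ξ)
    simpa using h
  have hψderiv : ∀ s ∈ Ico 0 T, HasDerivWithinAt (fun s => ‖(L s - L₁ s) ξ‖ ^ 2)
      (2 * ⟪(L s - L₁ s) ξ, ((A₂₁ s + (A₂₂ s).comp (L s) - (L s).comp (A₁₁ s) - ((L s).comp (A₁₂ s)).comp (L s)) -
        (A₂₁ s + (A₂₂ s).comp (L₁ s))) ξ⟫_ℝ) (Ici s) s :=
    fun s hs => (hvderiv s hs).norm_sq.hasDerivWithinAt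
  have hψ0 : ‖(L 0 - L₁ 0) ξ‖ ^ 2 ≤ m ^ 2 := by
    have e0 : (L 0 - L₁ 0) ξ = 0 := by rw [h10, sub_self]; rfl
    rw [e0, norm_zero, zero_pow two_ne_zero]; positivity
  have key := image_le_of_deriv_right_lt_deriv_boundary' (f := fun s => ‖(L s - L₁ s) ξ‖ ^ 2) hvcont hψderiv
    (B := fun _ => m ^ 2) (B' := fun _ => (0:ℝ)) hψ0 continuousOn_const (fun s _ => (hasDerivAt_const s (m ^ 2)).hasDerivWithinAt) ?_
  · have h1 : ‖(L t - L₁ t) ξ‖ ^ 2 ≤ m ^ 2 := key ht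
    exact (pow_le_pow_iff_left₀ (norm_nonneg _) hmpos.le two_ne_zero).mp h1
  · intro s hs hψm
    have hsI := Ico_subset_Icc_self hs
    have hin := inner_apply_duhamelDefect_le (A₂₁ := A₂₁ s) (L₁ := L₁ s) (hA₂₂ s hsI) (h₁₁ s hsI) (h₁₂ s hsI) (hball s hsI) hξ
    have hnorm : ‖(L s - L₁ s) ξ‖ = m := (pow_left_inj₀ (norm_nonneg _) hmpos.le two_ne_zero).mp hψm
    rw [hnorm] at hin
    have hγεm : 0 < γ * ε * m := by positivity
    have e : -γ * m ^ 2 + r * (s₀ + δ * r) * m = -(γ * ε * m) := by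
      rw [hm]; field_simp; ring
    nlinarith [hin, e, hγεm]

end Duhamel

end SlowGraph

end Summit.AnomalousDissipation.AnomalousDissipation.Theorems.SolenoidalFractalHomogenisation.LagrangianStep

end
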